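import Summits.NavierStokesRegularity.NavierStokesRegularity.Theses.HubbleDynamo
import Summits.NavierStokesRegularity.NavierStokesRegularity.Theses.ExtremalTypeIConstant
import Summits.NavierStokesRegularity.NavierStokesRegularity.Theses.SymmetryModuliCount
import Summits.NavierStokesRegularity.NavierStokesRegularity.Theorems.HubbleDynamoNoSelfExcitedDynamoEquivalence
import Literature.Analysis.FluidPDE.TypeIAncientMild
import HarnessLib

/-!
# Crux `NoSelfExcitedDynamo` (stmt-NavierStokesRegularity-1934): the crux follows from the target
  `TypeIAncientLiouville` (stmt-NavierStokesRegularity-4050) of routes ExtremalTypeIConstant /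
  SymmetryModuliCount

Theorems file (lands `--supports stmt-NavierStokesRegularity-1934`; registered sub-goal
`noSelfExcitedDynamo_of_typeIAncientLiouville`). Cross-route bookkeeping: `TypeIAncientLiouville`
(the Liouville theorem for smooth, divergence-free, KNSS-mild ancient fields with the Type-I bound IN
TIME ONLY, `‖u(t, x)‖ ≤ C/√(−t)`) implies `NoSelfExcitedDynamo` (the same in the POINTWISE class
`‖u(t, x)‖ ≤ C/(‖x‖ + √(−t))` of bounded ancient mild solutions in the duality form). Proof: by the
landed reduction `stub_eternalReduction` (p151325) it suffices to kill every eternal profile-class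
solution `(U, P)` of Leray's backward system; its physical field `u = ofLerayOrbit U` is a Type-I
ancient mild field in the sense of `IsTypeIAncientMild K₀` (`bridge_isTypeIAncientMild_ofLerayOrbit`:
classical on `(−∞, 0)` by the dictionary, KNSS-mild between negative times by KNSS 2009 Thm 6.1's
mildness clause `KNSS2009_mild_of_rMulNorm_bounded_holds` applied window-wise with the bounds
`‖u‖ ≤ K₀/√(−t)`, `r‖u‖ ≤ K₀` — no boundedness near `t = 0` is needed —, and `‖u‖ ≤ K₀/√(−t)`), so
`TypeIAncientLiouville` gives `u ≡ 0` on `t < 0`, i.e. `U ≡ 0`.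

So crux 1934 ≤ target 4050 in strength; together with `typeIDSSLiouvilleConjecture_of_noSelfExcitedDynamo`
(p154869): `TypeIAncientLiouville ⇒ NoSelfExcitedDynamo ⇒ TypeIDSSLiouvilleConjecture`.
-/

noncomputable section

-- the mandated stub namespace repeats `NavierStokesRegularity` (tree precedent for this crux's stubs)
set_option linter.dupNamespace false

namespace Summit.NavierStokesRegularity.NavierStokesRegularity.Theorems.NoSelfExcitedDynamo.Registered

open Set MeasureTheory Filter Topology
open scoped ContDiff
open Literature.Analysis.FluidPDE

/-- **The physical field of an eternal profile-class solution is a Type-I ancient mild field**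
(`IsTypeIAncientMild K₀`, `K₀` the `k = 0` profile constant): `u = ofLerayOrbit U` is jointly smooth
on `t < 0` and divergence free (it is classical there, `isClassicalNSSolutionOn_Iio_ofLerayOrbit_iff`),
satisfies the Oseen integral identity `u(t) = e^{(t−s)Δ}u(s) − B¹_s(u,u)(t)` between all pairs of
negative times (KNSS 2009, Thm 6.1, mildness clause, applied on the window `(s − 1, 0)` up to time
`t`, where `‖u‖ ≤ K₀/√(−t)` and `r‖u‖ ≤ K₀`), and has the Type-I time decay `‖u(t, x)‖ ≤ K₀/√(−t)`.
No switch-off / boundedness near `t = 0` is used. -/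
theorem bridge_isTypeIAncientMild_ofLerayOrbit
    {U : ℝ → EuclideanSpace ℝ (Fin 3) → EuclideanSpace ℝ (Fin 3)} {P : ℝ → EuclideanSpace ℝ (Fin 3) → ℝ}
    (hL : IsBackwardLeraySolutionOn univ 1 U P) {K₀ : ℝ} (hK₀ : ∀ s y, (1 + ‖y‖) * ‖U s y‖ ≤ K₀) :
    IsTypeIAncientMild K₀ (ofLerayOrbit U) := by
  set u := ofLerayOrbit U with hu_def
  have hcl : IsClassicalNSSolutionOn (Iio 0) 1 0 u (ofLerayOrbitPressure P) :=
    isClassicalNSSolutionOn_Iio_ofLerayOrbit_iff.2 hL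
  -- pointwise Type-I decay with the `k = 0` profile constant
  have hdec : HasTypeIDecay K₀ u := by
    refine hasTypeIDecay_iff_lerayOrbit.2 fun s y => ?_
    rw [hu_def, lerayOrbit_ofLerayOrbit_eq]
    exact hK₀ s y
  have hK0 : 0 ≤ K₀ := by
    have h := (norm_nonneg _).trans (hdec (-1) (by norm_num) 0)
    have hden : (0 : ℝ) < ‖(0 : EuclideanSpace ℝ (Fin 3))‖ + Real.sqrt (-(-1)) := by
      rw [norm_zero, zero_add, neg_neg, Real.sqrt_one]; exact one_pos
    exact (div_nonneg_iff.1 h).elim (fun h => h.1) fun h => absurd h.2 (not_le.2 hden)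
  have htime : HasTypeITimeDecay K₀ u := hdec.hasTypeITimeDecay hK0
  -- the Oseen identity between all pairs of negative times (KNSS Thm 6.1, mildness clause)
  have hmild : ∀ s t : ℝ, s < t → t < 0 → ∀ x,
      u t x = Literature.Analysis.UnboundedOperators.heatExtension (u s) (t - s) x - oseenDuhamel 1 s u u t x := by
    intro s t hst ht x
    have hwin : IsClassicalNSSolutionOn (Ioo (s - 1) 0) 1 0 u (ofLerayOrbitPressure P) :=
      hcl.mono (fun τ hτ => hτ.2) (uniqueDiffOn_Ioo _ _)
    have hst' : 0 < Real.sqrt (-t) := Real.sqrt_pos.2 (neg_pos.2 ht)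
    have hL' : ∃ L : ℝ, ∀ τ ∈ Ioc (s - 1) t, ∀ x, ‖u τ x‖ ≤ L := by
      refine ⟨K₀ / Real.sqrt (-t), fun τ hτ x => ?_⟩
      have hτ0 : τ < 0 := hτ.2.trans_lt ht
      refine (htime τ hτ0 x).trans ?_
      exact div_le_div_of_nonneg_left hK0 hst' (Real.sqrt_le_sqrt (by linarith [hτ.2]))
    have hD : ∃ D : ℝ, ∀ τ ∈ Ioc (s - 1) t, ∀ x, cylRadius x * ‖u τ x‖ ≤ D :=
      ⟨K₀, fun τ hτ x => reduction_cylRadius_mul_norm_le hdec τ (hτ.2.trans_lt ht) x⟩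
    exact KNSS2009_mild_of_rMulNorm_bounded_holds hwin (by linarith) ht hL' hD (by linarith) hst
      le_rfl x
  refine ⟨hcl.smooth_velocity, fun t ht => hcl.divFree t ht, fun s t hst ht x => ?_, htime⟩
  rw [heatFlow_of_pos _ (sub_pos.2 hst)]
  exact hmild s t hst ht x

/-- **`TypeIAncientLiouville → NoSelfExcitedDynamo`** (registered sub-goal
`noSelfExcitedDynamo_of_typeIAncientLiouville`): the target of routes ExtremalTypeIConstant /
SymmetryModuliCount (stmt-NavierStokesRegularity-4050; Liouville in the Type-I-in-time class) implies
this route's crux (Liouville in the pointwise Type-I class). By `stub_eternalReduction` it suffices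
to kill eternal profile-class solutions of Leray's backward system; their physical fields are Type-I
ancient mild fields (`bridge_isTypeIAncientMild_ofLerayOrbit`), which `TypeIAncientLiouville`
annihilates, and `U = lerayOrbit (ofLerayOrbit U)`. -/
theorem noSelfExcitedDynamo_of_typeIAncientLiouville :
    Theses.ExtremalTypeIConstant.TypeIAncientLiouville → Theses.HubbleDynamo.NoSelfExcitedDynamo := by
  intro hTAL
  refine stub_eternalReduction fun U P hL hprof _ => ?_
  obtain ⟨K₀, hK₀'⟩ := hprof 0
  have hK₀ : ∀ s y, (1 + ‖y‖) * ‖U s y‖ ≤ K₀ := fun s y => by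
    have h := hK₀' s y
    rwa [zero_add, pow_one, norm_iteratedFDeriv_zero] at h
  have hclass := isTypeIAncientMild_iff.1 (bridge_isTypeIAncientMild_ofLerayOrbit hL hK₀)
  have hzero : ∀ t < 0, ∀ x, ofLerayOrbit U t x = 0 := hTAL K₀ (ofLerayOrbit U) hclass
  intro s y
  have e : U s y = lerayOrbit (ofLerayOrbit U) s y := by rw [lerayOrbit_ofLerayOrbit_eq]
  rw [e, lerayOrbit_apply, hzero _ (neg_exp_neg_lt_zero s)]
  simp

/-- The same bridge from the copy of the target on route SymmetryModuliCount (identical definiens). -/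
theorem noSelfExcitedDynamo_of_typeIAncientLiouville' :
    Theses.SymmetryModuliCount.TypeIAncientLiouville → Theses.HubbleDynamo.NoSelfExcitedDynamo :=
  fun h => noSelfExcitedDynamo_of_typeIAncientLiouville h

end Summit.NavierStokesRegularity.NavierStokesRegularity.Theorems.NoSelfExcitedDynamo.Registered

end
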